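import Summits.Ventures.HSemireg.TwoSlotFrameTable
import Summits.Ventures.HSemireg.MixedFrameLeadingDigit

/-!
# Glue: LEMMA A(b)'s obstruction on the exterior-algebra frame (pub-hsemireg, S4-PUSH corner 2)

Companion of `Summits/Ventures/HSemireg/TwoSlotGlue.lean` (cell `pub-hsemireg`, seat s4-search-2 gen 14) for the OTHER frame
of the M2 edge unit: dual type `(1,2,3,3,3,3)` (63 classes), LEMMA A(b) of `s4push/search-2/g11/LIFT2-search-2-g11.md` §5 =
`MixedFrameLeadingDigit.obstruction_mixed` (k = 211).  Same two steps as in `TwoSlotGlue`: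

* `obstruction_mixed_frame` (any commutative ring; `F = c₁l₁ + ⋯ + c₄l₄` ANY cross-line element — all five memo cases at once):
  the hypotheses of `obstruction_mixed` that are atom relations (`h₀N = h₁N = 0`, `h₀F = h₁F = 0`, `F·N = ϖh₀h₁` with
  `ϖ = c₂n₃ + c₃n₂ − c₁n₄ − c₄n₁`, `S₁G = S₄`) are DERIVED from the entries of the 2-vector table
  (`TwoSlotFrameTable.crossLine_h₀ ∕ crossLine_h₁ ∕ crossLine_pair₁…₄ ∕ slotSum_G`); the table entries stay hypotheses.
* `obstruction_mixed_exterior` (Mathlib's `ExteriorAlgebra R M`, any twelve vectors): the table entries are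
  `TwoSlotFrameTable.twoVector_mul_self ∕ table_zero_* ∕ table_signed`, used in the commutative 2-vector (= even) subalgebra
  `Λ := Algebra.adjoin R {ι x · ι y}` (commutative by `TwoSlotFrameTable.twoVector_comm` + Mathlib's `Algebra.isMulCommutative_adjoin`,
  re-derived here in two lines so that this file imports only `TwoSlotFrameTable` and `MixedFrameLeadingDigit`; it is the even part by
  `TwoSlotGlue.twoVectorSubalgebra_eq_even`), where the frame theorem
  is instantiated and pushed through `Λ → ExteriorAlgebra R M`: the identity for the ACTUAL 2-vectors with no table entry among
  the hypotheses.

Honest framing as in the companions: ring identities (theorems only, count-neutral, no `def`); the READING «`x₀⋯x₁₁ ∈ 2Λ^{ev}ℤ¹²`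
is impossible, so none of the 28 leading digits admits a first digit» and the three parity cases producing `f` stay pencil ∕
machine; CLASS-LEVEL necessary-condition bookkeeping (CRITERION L) at the special fibre `E⁶`; nothing here is an object, a `σ`
computation or a Hodge statement, and nothing here bears on HC ∕ HC_CM ∕ HC_AV.
-/

namespace Summit.Ventures.HSemireg.MixedFrameGlue

open TwoSlotFrameTable MixedFrameLeadingDigit

section Frame

/-! ### 1. LEMMA A(b)'s obstruction on the h∕l-level frame (any commutative ring; table entries as hypotheses) -/

variable {R : Type*} [CommRing R]

/-- **LEMMA A(b)'s obstruction on the frame — every cross-line functional at once.**  Leading digit `C = β₀₁h₀ + β₂₃h₁ + N`,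
`N = n₁l₁ + ⋯ + n₄l₄`; functional `f = f₀₁h₀ + f₂₃h₁ + F` with `F = c₁l₁ + ⋯ + c₄l₄` ANY cross-line element (the memo's cases
`F = 0, l₁, …, l₄` and every combination), `ϖ := c₂n₃ + c₃n₂ − c₁n₄ − c₄n₁` its pairing with `N` (`F·N = ϖ·h₀h₁`, assembled from
`TwoSlotFrameTable.crossLine_pair₁…₄`), `f₂₃ = 2r + 1` odd and `f₀₁β₂₃ + f₂₃β₀₁ + ϖ = 2m`; `G = h₃h₄h₅`.  Hypotheses: the table
entries needed (`h₀² = h₁² = h₃² = h₄² = h₅² = 0`, `lⱼ² = 0`, `hᵢlⱼ = 0`, `l₁l₂ = l₁l₃ = l₂l₄ = l₃l₄ = 0`, `l₁l₄ = −h₀h₁`, `l₂l₃ = h₀h₁`)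
and the definitions; `obstruction_mixed`'s `zh₀N, zh₁N, zh₀F, zh₁F, hFN, hS₁G` are derived (`crossLine_h₀ ∕ h₁ ∕ pairⱼ`, `slotSum_G`):
any solution `X` of the digit equation `e·h₀h₁ + h₀S₁ + CX = 2W` forces `h₀h₁S₄ ∈ 2R`. -/
theorem obstruction_mixed_frame (h₀ h₁ l₁ l₂ l₃ l₄ h₂ h₃ h₄ h₅ m r e f₀₁ f₂₃ ϖ β₀₁ β₂₃ n₁ n₂ n₃ n₄ c₁ c₂ c₃ c₄
    S₁ S₄ G N F f C X W : R) (qh₀ : h₀ * h₀ = 0) (qh₁ : h₁ * h₁ = 0) (qh₃ : h₃ * h₃ = 0) (qh₄ : h₄ * h₄ = 0)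
    (qh₅ : h₅ * h₅ = 0) (ql₁ : l₁ * l₁ = 0) (ql₂ : l₂ * l₂ = 0) (ql₃ : l₃ * l₃ = 0) (ql₄ : l₄ * l₄ = 0)
    (zh₀l₁ : h₀ * l₁ = 0) (zh₀l₂ : h₀ * l₂ = 0) (zh₀l₃ : h₀ * l₃ = 0) (zh₀l₄ : h₀ * l₄ = 0) (zh₁l₁ : h₁ * l₁ = 0)
    (zh₁l₂ : h₁ * l₂ = 0) (zh₁l₃ : h₁ * l₃ = 0) (zh₁l₄ : h₁ * l₄ = 0) (zl₁l₂ : l₁ * l₂ = 0) (zl₁l₃ : l₁ * l₃ = 0)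
    (zl₂l₄ : l₂ * l₄ = 0) (zl₃l₄ : l₃ * l₄ = 0) (pl₁l₄ : l₁ * l₄ = -(h₀ * h₁)) (pl₂l₃ : l₂ * l₃ = h₀ * h₁)
    (hS₁ : S₁ = h₂ + h₃ + h₄ + h₅) (hS₄ : S₄ = h₂ * h₃ * h₄ * h₅) (hG : G = h₃ * h₄ * h₅)
    (hN : N = n₁ * l₁ + n₂ * l₂ + n₃ * l₃ + n₄ * l₄) (hF : F = c₁ * l₁ + c₂ * l₂ + c₃ * l₃ + c₄ * l₄)
    (hϖ : ϖ = c₂ * n₃ + c₃ * n₂ - c₁ * n₄ - c₄ * n₁) (hC : C = β₀₁ * h₀ + β₂₃ * h₁ + N)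
    (hf : f = f₀₁ * h₀ + f₂₃ * h₁ + F) (hX : e * (h₀ * h₁) + h₀ * S₁ + C * X = 2 * W)
    (hm : f₀₁ * β₂₃ + f₂₃ * β₀₁ + ϖ = 2 * m) (hr : f₂₃ = 2 * r + 1) :
    h₀ * h₁ * S₄ = 2 * (f * (G * W) - m * (h₀ * h₁ * (X * G)) - r * (h₀ * h₁ * S₄)) := by
  have zh₀N : h₀ * N = 0 := crossLine_h₀ h₀ l₁ l₂ l₃ l₄ n₁ n₂ n₃ n₄ N hN zh₀l₁ zh₀l₂ zh₀l₃ zh₀l₄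
  have zh₁N : h₁ * N = 0 := crossLine_h₁ h₁ l₁ l₂ l₃ l₄ n₁ n₂ n₃ n₄ N hN zh₁l₁ zh₁l₂ zh₁l₃ zh₁l₄
  have zh₀F : h₀ * F = 0 := crossLine_h₀ h₀ l₁ l₂ l₃ l₄ c₁ c₂ c₃ c₄ F hF zh₀l₁ zh₀l₂ zh₀l₃ zh₀l₄
  have zh₁F : h₁ * F = 0 := crossLine_h₁ h₁ l₁ l₂ l₃ l₄ c₁ c₂ c₃ c₄ F hF zh₁l₁ zh₁l₂ zh₁l₃ zh₁l₄
  have e₁ := crossLine_pair₁ h₀ h₁ l₁ l₂ l₃ l₄ n₁ n₂ n₃ n₄ N hN ql₁ zl₁l₂ zl₁l₃ pl₁l₄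
  have e₂ := crossLine_pair₂ h₀ h₁ l₁ l₂ l₃ l₄ n₁ n₂ n₃ n₄ N hN ql₂ zl₁l₂ zl₂l₄ pl₂l₃
  have e₃ := crossLine_pair₃ h₀ h₁ l₁ l₂ l₃ l₄ n₁ n₂ n₃ n₄ N hN ql₃ zl₁l₃ zl₃l₄ pl₂l₃
  have e₄ := crossLine_pair₄ h₀ h₁ l₁ l₂ l₃ l₄ n₁ n₂ n₃ n₄ N hN ql₄ zl₂l₄ zl₃l₄ pl₁l₄
  have hFN : F * N = ϖ * (h₀ * h₁) := by
    rw [hF, hϖ]; linear_combination c₁ * e₁ + c₂ * e₂ + c₃ * e₃ + c₄ * e₄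
  have hS₁G : S₁ * G = S₄ := slotSum_G h₂ h₃ h₄ h₅ S₁ S₄ G hG hS₁ hS₄ qh₃ qh₄ qh₅
  exact obstruction_mixed h₀ h₁ m r e f₀₁ f₂₃ ϖ β₀₁ β₂₃ S₁ S₄ G N F f C X W hC hf qh₀ qh₁ zh₀N zh₁N zh₀F zh₁F
    hFN hS₁G hX hm hr

end Frame

section Exterior

/-! ### 2. The join: the same obstruction for the actual 2-vectors in Mathlib's `ExteriorAlgebra R M` -/

open ExteriorAlgebra (ι)
open scoped IsMulCommutative

variable {R : Type*} [CommRing R] {M : Type*} [AddCommGroup M] [Module R M]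

/-- **LEMMA A(b)'s obstruction in the exterior algebra (the join) — every cross-line functional at once.**  For ANY commutative
ring `R`, module `M` and twelve vectors `x₀, …, x₁₁` (slot `i` = `⟨x_{2i}, x_{2i+1}⟩`, `h₀ = ι x₀ ι x₁`, `h₁ = ι x₂ ι x₃`, cross lines
`l₁ = ι x₀ ι x₂, l₂ = ι x₀ ι x₃, l₃ = ι x₁ ι x₂, l₄ = ι x₁ ι x₃`, outer slots `h₂, …, h₅`), and ANY elements `m, r, e, f₀₁, f₂₃, β₀₁, β₂₃,
n₁, …, n₄, c₁, …, c₄, X, W` of the 2-vector (= even) subalgebra `Λ` with `F = c₁l₁ + ⋯ + c₄l₄`, `ϖ = c₂n₃ + c₃n₂ − c₁n₄ − c₄n₁`,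
`f₂₃ = 2r + 1`, `f₀₁β₂₃ + f₂₃β₀₁ + ϖ = 2m` and the digit equation `e·h₀h₁ + h₀S₁ + CX = 2W` (the premises as the memo prints them):
`obstruction_mixed`'s identity holds in `ExteriorAlgebra R M` with NO table entry among the hypotheses (all 23 needed entries are
`TwoSlotFrameTable.twoVector_mul_self ∕ table_zero_* ∕ table_signed`, used inside `Λ`).  The reading «impossible over ℤ» and the
parity case analysis producing a suitable `f` for each of the 28 leading digits stay pencil. -/
theorem obstruction_mixed_exterior (x₀ x₁ x₂ x₃ x₄ x₅ x₆ x₇ x₈ x₉ x₁₀ x₁₁ : M)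
    (Λ : Subalgebra R (ExteriorAlgebra R M)) (h₀ h₁ l₁ l₂ l₃ l₄ h₂ h₃ h₄ h₅ m r e f₀₁ f₂₃ ϖ β₀₁ β₂₃ n₁ n₂ n₃ n₄ c₁
    c₂ c₃ c₄ S₁ S₄ G N F f C X W : ExteriorAlgebra R M)
    (hΛ : Λ = Algebra.adjoin R (Set.range fun p : M × M => ι R p.1 * ι R p.2))
    (hh₀ : h₀ = ι R x₀ * ι R x₁) (hh₁ : h₁ = ι R x₂ * ι R x₃) (hl₁ : l₁ = ι R x₀ * ι R x₂)
    (hl₂ : l₂ = ι R x₀ * ι R x₃) (hl₃ : l₃ = ι R x₁ * ι R x₂) (hl₄ : l₄ = ι R x₁ * ι R x₃)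
    (hh₂ : h₂ = ι R x₄ * ι R x₅) (hh₃ : h₃ = ι R x₆ * ι R x₇) (hh₄ : h₄ = ι R x₈ * ι R x₉)
    (hh₅ : h₅ = ι R x₁₀ * ι R x₁₁) (mm : m ∈ Λ) (mr : r ∈ Λ) (me : e ∈ Λ) (mf₀₁ : f₀₁ ∈ Λ) (mf₂₃ : f₂₃ ∈ Λ)
    (mβ₀₁ : β₀₁ ∈ Λ) (mβ₂₃ : β₂₃ ∈ Λ) (mn₁ : n₁ ∈ Λ) (mn₂ : n₂ ∈ Λ) (mn₃ : n₃ ∈ Λ) (mn₄ : n₄ ∈ Λ)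
    (mc₁ : c₁ ∈ Λ) (mc₂ : c₂ ∈ Λ) (mc₃ : c₃ ∈ Λ) (mc₄ : c₄ ∈ Λ) (mX : X ∈ Λ) (mW : W ∈ Λ)
    (hS₁ : S₁ = h₂ + h₃ + h₄ + h₅) (hS₄ : S₄ = h₂ * h₃ * h₄ * h₅) (hG : G = h₃ * h₄ * h₅)
    (hN : N = n₁ * l₁ + n₂ * l₂ + n₃ * l₃ + n₄ * l₄) (hF : F = c₁ * l₁ + c₂ * l₂ + c₃ * l₃ + c₄ * l₄)
    (hϖ : ϖ = c₂ * n₃ + c₃ * n₂ - c₁ * n₄ - c₄ * n₁) (hC : C = β₀₁ * h₀ + β₂₃ * h₁ + N)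
    (hf : f = f₀₁ * h₀ + f₂₃ * h₁ + F) (hX : e * (h₀ * h₁) + h₀ * S₁ + C * X = 2 * W)
    (hm : f₀₁ * β₂₃ + f₂₃ * β₀₁ + ϖ = 2 * m) (hr : f₂₃ = 2 * r + 1) :
    h₀ * h₁ * S₄ = 2 * (f * (G * W) - m * (h₀ * h₁ * (X * G)) - r * (h₀ * h₁ * S₄)) := by
  subst hΛ
  haveI : IsMulCommutative (Algebra.adjoin R (Set.range fun p : M × M => ι R p.1 * ι R p.2)) :=
    Algebra.isMulCommutative_adjoin R (by
      rintro _ ⟨⟨u, v⟩, rfl⟩ _ ⟨⟨u', v'⟩, rfl⟩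
      exact twoVector_comm u v u' v')
  set Λ := Algebra.adjoin R (Set.range fun p : M × M => ι R p.1 * ι R p.2)
  have mh₀ : h₀ ∈ Λ := Algebra.subset_adjoin ⟨(x₀, x₁), hh₀.symm⟩
  have mh₁ : h₁ ∈ Λ := Algebra.subset_adjoin ⟨(x₂, x₃), hh₁.symm⟩
  have ml₁ : l₁ ∈ Λ := Algebra.subset_adjoin ⟨(x₀, x₂), hl₁.symm⟩
  have ml₂ : l₂ ∈ Λ := Algebra.subset_adjoin ⟨(x₀, x₃), hl₂.symm⟩
  have ml₃ : l₃ ∈ Λ := Algebra.subset_adjoin ⟨(x₁, x₂), hl₃.symm⟩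
  have ml₄ : l₄ ∈ Λ := Algebra.subset_adjoin ⟨(x₁, x₃), hl₄.symm⟩
  have mh₂ : h₂ ∈ Λ := Algebra.subset_adjoin ⟨(x₄, x₅), hh₂.symm⟩
  have mh₃ : h₃ ∈ Λ := Algebra.subset_adjoin ⟨(x₆, x₇), hh₃.symm⟩
  have mh₄ : h₄ ∈ Λ := Algebra.subset_adjoin ⟨(x₈, x₉), hh₄.symm⟩
  have mh₅ : h₅ ∈ Λ := Algebra.subset_adjoin ⟨(x₁₀, x₁₁), hh₅.symm⟩
  -- the 23 table entries, as equations in Λ, from the exterior algebra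
  have qh₀ : (⟨h₀, mh₀⟩ : Λ) * ⟨h₀, mh₀⟩ = 0 := Subtype.ext (by subst hh₀; exact twoVector_mul_self x₀ x₁)
  have qh₁ : (⟨h₁, mh₁⟩ : Λ) * ⟨h₁, mh₁⟩ = 0 := Subtype.ext (by subst hh₁; exact twoVector_mul_self x₂ x₃)
  have qh₃ : (⟨h₃, mh₃⟩ : Λ) * ⟨h₃, mh₃⟩ = 0 := Subtype.ext (by subst hh₃; exact twoVector_mul_self x₆ x₇)
  have qh₄ : (⟨h₄, mh₄⟩ : Λ) * ⟨h₄, mh₄⟩ = 0 := Subtype.ext (by subst hh₄; exact twoVector_mul_self x₈ x₉)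
  have qh₅ : (⟨h₅, mh₅⟩ : Λ) * ⟨h₅, mh₅⟩ = 0 :=
    Subtype.ext (by subst hh₅; exact twoVector_mul_self x₁₀ x₁₁)
  have ql₁ : (⟨l₁, ml₁⟩ : Λ) * ⟨l₁, ml₁⟩ = 0 := Subtype.ext (by subst hl₁; exact twoVector_mul_self x₀ x₂)
  have ql₂ : (⟨l₂, ml₂⟩ : Λ) * ⟨l₂, ml₂⟩ = 0 := Subtype.ext (by subst hl₂; exact twoVector_mul_self x₀ x₃)
  have ql₃ : (⟨l₃, ml₃⟩ : Λ) * ⟨l₃, ml₃⟩ = 0 := Subtype.ext (by subst hl₃; exact twoVector_mul_self x₁ x₂)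
  have ql₄ : (⟨l₄, ml₄⟩ : Λ) * ⟨l₄, ml₄⟩ = 0 := Subtype.ext (by subst hl₄; exact twoVector_mul_self x₁ x₃)
  have zh₀l₁ : (⟨h₀, mh₀⟩ : Λ) * ⟨l₁, ml₁⟩ = 0 := Subtype.ext (by subst hh₀ hl₁; exact table_zero_ff x₀ x₁ x₂)
  have zh₀l₂ : (⟨h₀, mh₀⟩ : Λ) * ⟨l₂, ml₂⟩ = 0 := Subtype.ext (by subst hh₀ hl₂; exact table_zero_ff x₀ x₁ x₃)
  have zh₀l₃ : (⟨h₀, mh₀⟩ : Λ) * ⟨l₃, ml₃⟩ = 0 := Subtype.ext (by subst hh₀ hl₃; exact table_zero_st x₀ x₁ x₂)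
  have zh₀l₄ : (⟨h₀, mh₀⟩ : Λ) * ⟨l₄, ml₄⟩ = 0 := Subtype.ext (by subst hh₀ hl₄; exact table_zero_st x₀ x₁ x₃)
  have zh₁l₁ : (⟨h₁, mh₁⟩ : Λ) * ⟨l₁, ml₁⟩ = 0 := Subtype.ext (by subst hh₁ hl₁; exact table_zero_fl x₂ x₃ x₀)
  have zh₁l₂ : (⟨h₁, mh₁⟩ : Λ) * ⟨l₂, ml₂⟩ = 0 := Subtype.ext (by subst hh₁ hl₂; exact table_zero_sl x₂ x₃ x₀)
  have zh₁l₃ : (⟨h₁, mh₁⟩ : Λ) * ⟨l₃, ml₃⟩ = 0 := Subtype.ext (by subst hh₁ hl₃; exact table_zero_fl x₂ x₃ x₁)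
  have zh₁l₄ : (⟨h₁, mh₁⟩ : Λ) * ⟨l₄, ml₄⟩ = 0 := Subtype.ext (by subst hh₁ hl₄; exact table_zero_sl x₂ x₃ x₁)
  have zl₁l₂ : (⟨l₁, ml₁⟩ : Λ) * ⟨l₂, ml₂⟩ = 0 := Subtype.ext (by subst hl₁ hl₂; exact table_zero_ff x₀ x₂ x₃)
  have zl₁l₃ : (⟨l₁, ml₁⟩ : Λ) * ⟨l₃, ml₃⟩ = 0 := Subtype.ext (by subst hl₁ hl₃; exact table_zero_sl x₀ x₂ x₁)
  have zl₂l₄ : (⟨l₂, ml₂⟩ : Λ) * ⟨l₄, ml₄⟩ = 0 := Subtype.ext (by subst hl₂ hl₄; exact table_zero_sl x₀ x₃ x₁)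
  have zl₃l₄ : (⟨l₃, ml₃⟩ : Λ) * ⟨l₄, ml₄⟩ = 0 := Subtype.ext (by subst hl₃ hl₄; exact table_zero_ff x₁ x₂ x₃)
  have pl₁l₄ : (⟨l₁, ml₁⟩ : Λ) * ⟨l₄, ml₄⟩ = -(⟨h₀, mh₀⟩ * ⟨h₁, mh₁⟩) :=
    Subtype.ext (by subst hl₁ hl₄ hh₀ hh₁; exact (table_signed x₀ x₁ x₂ x₃).1)
  have pl₂l₃ : (⟨l₂, ml₂⟩ : Λ) * ⟨l₃, ml₃⟩ = ⟨h₀, mh₀⟩ * ⟨h₁, mh₁⟩ :=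
    Subtype.ext (by subst hl₂ hl₃ hh₀ hh₁; exact (table_signed x₀ x₁ x₂ x₃).2)
  subst hS₁ hS₄ hG hN hF hϖ hC hf
  have key := congrArg Subtype.val
    (obstruction_mixed_frame (R := Λ) ⟨h₀, mh₀⟩ ⟨h₁, mh₁⟩ ⟨l₁, ml₁⟩ ⟨l₂, ml₂⟩ ⟨l₃, ml₃⟩ ⟨l₄, ml₄⟩
      ⟨h₂, mh₂⟩ ⟨h₃, mh₃⟩ ⟨h₄, mh₄⟩ ⟨h₅, mh₅⟩ ⟨m, mm⟩ ⟨r, mr⟩ ⟨e, me⟩ ⟨f₀₁, mf₀₁⟩ ⟨f₂₃, mf₂₃⟩ _ ⟨β₀₁, mβ₀₁⟩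
      ⟨β₂₃, mβ₂₃⟩ ⟨n₁, mn₁⟩ ⟨n₂, mn₂⟩ ⟨n₃, mn₃⟩ ⟨n₄, mn₄⟩ ⟨c₁, mc₁⟩ ⟨c₂, mc₂⟩ ⟨c₃, mc₃⟩ ⟨c₄, mc₄⟩ _ _ _ _ _
      _ _ ⟨X, mX⟩ ⟨W, mW⟩ qh₀ qh₁ qh₃ qh₄ qh₅ ql₁ ql₂ ql₃ ql₄ zh₀l₁ zh₀l₂ zh₀l₃ zh₀l₄ zh₁l₁ zh₁l₂ zh₁l₃ zh₁l₄
      zl₁l₂ zl₁l₃ zl₂l₄ zl₃l₄ pl₁l₄ pl₂l₃ rfl rfl rfl rfl rfl rfl rfl rfl (Subtype.ext (by push_cast; exact hX))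
      (Subtype.ext (by push_cast; exact hm)) (Subtype.ext (by push_cast; exact hr)))
  push_cast at key ⊢
  exact key

end Exterior

end Summit.Ventures.HSemireg.MixedFrameGlue
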